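import Summits.QuantumFields.YangMills.Theorems.LuscherReductionTwistedTraceScalingInnerSymmetry
import Summits.QuantumFields.YangMills.Theorems.LuscherReductionTwistedTraceScalingStiffTrialMeasurable
import Summits.QuantumFields.YangMills.Theorems.LuscherReductionTwistedTraceScalingBTColourMean
import HarnessLib

/-!
# COLOUR AVERAGING KILLS THE FIRST ORDER: `∫_c Ad_c a dc = 0`, and the exponential sandwich `1 − ε₂ ≤ ∫_c exp(Σ_k (Ad_c a_k)·Y_k + X₂(c)) dc ≤ 1 + ε₂ + (ε₁+ε₂)²`
# — the ONLY cancellation the Laplace core of (B-T) needs (lane A of S-BASE, crux `TwistedTraceScaling` stmt-QuantumFields-20203, C4-CORE; design note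
# `pub/ym-fleet/ym-luscher-20007-p1/COARSE-DESIGN.md` §25.7)

By §25.7 the diagonal factor `f(u) = fpBOKernel(u,u)/K₁(u,u)` is compared with `f(1)` POINTWISE in the fluctuation variable after averaging over the global colour rotation `u ↦ cuc⁻¹`
(under which `f` is invariant): the exponent splits as `X = X⁽¹⁾ + X⁽²⁾` with `X⁽¹⁾ = Σ_k c_k(u)·Y_k(z)` EXACTLY LINEAR in colour vectors `c_k` that rotate with `u`, `|X⁽¹⁾| ≤ ε₁ = O(δlog²β)`,
`|X⁽²⁾| ≤ ε₂ = O(δ²log²β + β^{-1/2}log³β)`.  This file is the abstract engine: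
* §1 ★ `integral_adRot_mulVec_eq_zero` — `∫_c Ad(c)·a dHaar(c) = 0` for every `a ∈ ℝ³` (the integral is a vector fixed by every `Ad(d)`, left invariance; two half-turns kill it — `…InnerSymmetry`,
  `…ToronSymmetricFunctional`);
* §2 ★ `integral_exp_sandwich_of_integral_eq_zero` — on a probability space, `∫X₁ = 0`, `|X₁| ≤ ε₁`, `|X₂| ≤ ε₂`, `ε₁ + ε₂ ≤ 1` ⇒ `1 − ε₂ ≤ ∫exp(X₁ + X₂) ≤ 1 + ε₂ + (ε₁+ε₂)²`
  (`e^x ≥ 1 + x`, `|e^x − 1 − x| ≤ x²` for `|x| ≤ 1`);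
* §3 ★★ `haar_integral_exp_linear_sandwich` — the combination for `X₁(c) = Σ_k (Ad(c)a_k)·Y_k` with `ε₁ = Σ_k ‖a_k‖·‖Y_k‖`… stated with any bound `ε₁ ≥ Σ_k √(Σ a_k²)√(ΣY_k²)`.
HONEST FRAMING: elementary analysis for a stub of a child of the CONDITIONAL reduction route R2b1; the Laplace core of (B-T) is OPEN; C4-CORE OPEN; not infinite volume, not a gap, not Clay.
-/

set_option autoImplicit false

noncomputable section

open MeasureTheory Filter Topology Real
open scoped BigOperators Matrix
open Literature.MathematicalPhysics.QuantumFieldTheory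
open Literature.MathematicalPhysics.QuantumLattice

namespace Summit.QuantumFields.YangMills.Theorems.FemtoTransferGap.TwoLattice.ConstTube

open Summit.QuantumFields.YangMills.Theorems.FemtoTransferGap
open Summit.QuantumFields.YangMills.Theorems.FemtoTransferGap.TwoLattice.Cov (adRot_mul sum_sq_adRot_mulVec)
open Summit.QuantumFields.YangMills.Theorems.FemtoTransferGap.TwoLattice.Toron (exists_adRot_halfTurn_two adRot_diagSU2_halfTurn_mulVec)

/-! ## §1 The Haar average of a rotated vector vanishes -/

/-- `c ↦ Ad(c)·a` is continuous. [folklore] -/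
theorem continuous_adRot_mulVec (a : Fin 3 → ℝ) : Continuous fun c : SU2 => (adRot c).mulVec a :=
  Continuous.matrix_mulVec continuous_adRot continuous_const

/-- `c ↦ Ad(c)·a` is integrable against Haar. [folklore] -/
theorem integrable_adRot_mulVec (a : Fin 3 → ℝ) : Integrable (fun c : SU2 => (adRot c).mulVec a) (haarProbability SU2) := by
  haveI : SecondCountableTopology SU2 := secondCountableTopology_su2
  refine Integrable.of_bound (C := ‖a‖ * 3) (continuous_adRot_mulVec a).aestronglyMeasurable (ae_of_all _ fun c => ?_)
  rw [pi_norm_le_iff_of_nonneg (by positivity)]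
  intro i
  rw [Real.norm_eq_abs]
  have h1 : |(adRot c).mulVec a i| ^ 2 ≤ ∑ j, ((adRot c).mulVec a j) ^ 2 := by
    rw [sq_abs]; exact Finset.single_le_sum (f := fun j => ((adRot c).mulVec a j) ^ 2) (fun j _ => sq_nonneg _) (Finset.mem_univ i)
  rw [sum_sq_adRot_mulVec] at h1
  have h2 : ∑ j, a j ^ 2 ≤ 3 * ‖a‖ ^ 2 := by
    calc ∑ j, a j ^ 2 ≤ ∑ _j : Fin 3, ‖a‖ ^ 2 := Finset.sum_le_sum fun j _ => by
            rw [← sq_abs]; exact pow_le_pow_left₀ (abs_nonneg _) (by rw [← Real.norm_eq_abs]; exact norm_le_pi_norm a j) 2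
      _ = 3 * ‖a‖ ^ 2 := by simp
  nlinarith [abs_nonneg ((adRot c).mulVec a i), norm_nonneg a]

/-- ★ **`∫_c Ad(c)·a dc = 0`** (Haar probability on `SU(2)`). [cite: BrockerTomDieck1985, I (1.10)] -/
theorem integral_adRot_mulVec_eq_zero (a : Fin 3 → ℝ) : ∫ c, (adRot c).mulVec a ∂haarProbability SU2 = 0 := by
  set V : Fin 3 → ℝ := ∫ c, (adRot c).mulVec a ∂haarProbability SU2 with hV
  -- `V` is fixed by every rotation `Ad(d)`
  have hfix : ∀ d : SU2, (adRot d).mulVec V = V := fun d => by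
    have hL := ((Matrix.mulVecLin (adRot d)).toContinuousLinearMap).integral_comp_comm (integrable_adRot_mulVec a)
    have e1 : (fun c : SU2 => (Matrix.mulVecLin (adRot d)).toContinuousLinearMap ((adRot c).mulVec a)) = fun c => (adRot (d * c)).mulVec a := by
      funext c
      simp only [LinearMap.coe_toContinuousLinearMap', Matrix.mulVecLin_apply, Matrix.mulVec_mulVec, adRot_mul]
    rw [e1, integral_mul_left_eq_self (fun c : SU2 => (adRot c).mulVec a) d] at hL
    simp only [LinearMap.coe_toContinuousLinearMap', Matrix.mulVecLin_apply] at hL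
    rw [hV]; exact hL.symm
  -- two half-turns
  obtain ⟨J, hJ⟩ := exists_adRot_halfTurn_two
  have h1 := hfix J
  rw [hJ] at h1
  have h2 := hfix (diagSU2 (Real.pi / 2))
  rw [adRot_diagSU2_halfTurn_mulVec] at h2
  have e0 : V 0 = 0 := by have := congrFun h1 0; simp at this; linarith
  have e1 : V 1 = 0 := by have := congrFun h2 1; simp at this; linarith
  have e2 : V 2 = 0 := by have := congrFun h1 2; simp at this; linarith
  funext i
  fin_cases i
  · exact e0
  · exact e1
  · exact e2

/-- Componentwise: `∫_c (Ad(c)·a)_i dc = 0`. [folklore] -/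
theorem integral_adRot_mulVec_apply_eq_zero (a : Fin 3 → ℝ) (i : Fin 3) : ∫ c, (adRot c).mulVec a i ∂haarProbability SU2 = 0 := by
  have h := (ContinuousLinearMap.proj (R := ℝ) (φ := fun _ : Fin 3 => ℝ) i).integral_comp_comm (integrable_adRot_mulVec a)
  simp only [ContinuousLinearMap.proj_apply] at h
  rw [h, integral_adRot_mulVec_eq_zero]
  rfl

/-- The components are integrable. [folklore] -/
theorem integrable_adRot_mulVec_apply (a : Fin 3 → ℝ) (i : Fin 3) : Integrable (fun c : SU2 => (adRot c).mulVec a i) (haarProbability SU2) := by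
  have h := (ContinuousLinearMap.proj (R := ℝ) (φ := fun _ : Fin 3 => ℝ) i).integrable_comp (integrable_adRot_mulVec a)
  simpa only [ContinuousLinearMap.proj_apply] using h

/-- Consequently `∫_c (Ad(c)·a)·Y dc = 0` for all `a, Y ∈ ℝ³`. [folklore] -/
theorem integral_adRot_mulVec_dotProduct_eq_zero (a Y : Fin 3 → ℝ) : ∫ c, (adRot c).mulVec a ⬝ᵥ Y ∂haarProbability SU2 = 0 := by
  simp only [dotProduct]
  rw [integral_finsetSum _ fun i _ => (integrable_adRot_mulVec_apply a i).mul_const (Y i)]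
  simp [integral_mul_const, integral_adRot_mulVec_apply_eq_zero]

/-! ## §2 The exponential sandwich with a zero-mean linear part -/

/-- ★ On a probability space: `∫X₁ = 0`, `|X₁| ≤ ε₁`, `|X₂| ≤ ε₂`, `ε₁ + ε₂ ≤ 1` ⇒ `1 − ε₂ ≤ ∫exp(X₁ + X₂) ≤ 1 + ε₂ + (ε₁ + ε₂)²`. [folklore] -/
theorem integral_exp_sandwich_of_integral_eq_zero {C : Type*} [MeasurableSpace C] (ν : Measure C) [IsProbabilityMeasure ν] {X₁ X₂ : C → ℝ}
    (hX₁m : Measurable X₁) (hX₂m : Measurable X₂) {ε₁ ε₂ : ℝ} (h1 : ∀ c, |X₁ c| ≤ ε₁) (h2 : ∀ c, |X₂ c| ≤ ε₂) (hε : ε₁ + ε₂ ≤ 1)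
    (hmean : ∫ c, X₁ c ∂ν = 0) :
    1 - ε₂ ≤ ∫ c, Real.exp (X₁ c + X₂ c) ∂ν ∧ ∫ c, Real.exp (X₁ c + X₂ c) ∂ν ≤ 1 + ε₂ + (ε₁ + ε₂) ^ 2 := by
  have hX : ∀ c, |X₁ c + X₂ c| ≤ ε₁ + ε₂ := fun c => (abs_add_le _ _).trans (add_le_add (h1 c) (h2 c))
  have hi1 : Integrable X₁ ν := integrable_of_measurable_abs_le _ hX₁m h1
  have hi2 : Integrable X₂ ν := integrable_of_measurable_abs_le _ hX₂m h2
  have hiexp : Integrable (fun c => Real.exp (X₁ c + X₂ c)) ν :=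
    integrable_of_measurable_abs_le _ (Real.measurable_exp.comp (hX₁m.add hX₂m)) (C := Real.exp 1) fun c => by
      rw [abs_of_pos (Real.exp_pos _)]; exact Real.exp_le_exp.mpr ((le_abs_self _).trans ((hX c).trans hε))
  have hisq : Integrable (fun c => (X₁ c + X₂ c) ^ 2) ν :=
    integrable_of_measurable_abs_le _ ((hX₁m.add hX₂m).pow_const 2) (C := (ε₁ + ε₂) ^ 2) fun c => by
      rw [abs_pow]; exact pow_le_pow_left₀ (abs_nonneg _) (hX c) 2
  have hI2 : |∫ c, X₂ c ∂ν| ≤ ε₂ := by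
    calc |∫ c, X₂ c ∂ν| ≤ ∫ c, |X₂ c| ∂ν := abs_integral_le_integral_abs
      _ ≤ ∫ _c, ε₂ ∂ν := integral_mono_of_nonneg (ae_of_all _ fun _ => abs_nonneg _) (integrable_const _) (ae_of_all _ h2)
      _ = ε₂ := by simp
  constructor
  · -- lower: `e^x ≥ 1 + x`
    have hpt : ∀ c, 1 + (X₁ c + X₂ c) ≤ Real.exp (X₁ c + X₂ c) := fun c => by linarith [Real.add_one_le_exp (X₁ c + X₂ c)]
    have hi12 : Integrable (fun c => X₁ c + X₂ c) ν := hi1.add hi2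
    have h := integral_mono (f := fun c => 1 + (X₁ c + X₂ c)) (g := fun c => Real.exp (X₁ c + X₂ c)) ((integrable_const (1 : ℝ)).add hi12) hiexp hpt
    have e : ∫ c, (1 + (X₁ c + X₂ c)) ∂ν = 1 + ∫ c, X₂ c ∂ν := by
      rw [integral_add (integrable_const _) hi12, integral_add hi1 hi2, hmean]; simp
    rw [e] at h
    linarith [(abs_le.mp hI2).1]
  · -- upper: `e^x ≤ 1 + x + x²` for `|x| ≤ 1`
    have hpt : ∀ c, Real.exp (X₁ c + X₂ c) ≤ 1 + (X₁ c + X₂ c) + (X₁ c + X₂ c) ^ 2 := fun c => by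
      have h := Real.abs_exp_sub_one_sub_id_le ((hX c).trans hε)
      linarith [(abs_le.mp h).2]
    have hi12 : Integrable (fun c => X₁ c + X₂ c) ν := hi1.add hi2
    have h := integral_mono (f := fun c => Real.exp (X₁ c + X₂ c)) (g := fun c => 1 + (X₁ c + X₂ c) + (X₁ c + X₂ c) ^ 2) hiexp
      (((integrable_const (1 : ℝ)).add hi12).add hisq) hpt
    have hi1s : Integrable (fun c => 1 + (X₁ c + X₂ c)) ν := (integrable_const (1 : ℝ)).add hi12
    have e : ∫ c, (1 + (X₁ c + X₂ c) + (X₁ c + X₂ c) ^ 2) ∂ν = 1 + ∫ c, X₂ c ∂ν + ∫ c, (X₁ c + X₂ c) ^ 2 ∂ν := by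
      rw [integral_add hi1s hisq, integral_add (integrable_const _) hi12, integral_add hi1 hi2, hmean]; simp
    rw [e] at h
    have hsq : ∫ c, (X₁ c + X₂ c) ^ 2 ∂ν ≤ (ε₁ + ε₂) ^ 2 := by
      calc ∫ c, (X₁ c + X₂ c) ^ 2 ∂ν ≤ ∫ _c, (ε₁ + ε₂) ^ 2 ∂ν :=
            integral_mono hisq (integrable_const _) fun c => by
              have := hX c; rw [← sq_abs]; exact pow_le_pow_left₀ (abs_nonneg _) this 2
        _ = (ε₁ + ε₂) ^ 2 := by simp
    linarith [(abs_le.mp hI2).2]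

/-! ## §3 ★★ The combination -/

/-- ★★ **Haar averaging of a rotated linear exponent**: for colour vectors `a_k` and coefficients `Y_k` (`k ∈ ι`), and a measurable `X₂` with `|X₂| ≤ ε₂`, if
`Σ_k |(Ad(c)a_k)·Y_k| ≤ ε₁` for all `c` and `ε₁ + ε₂ ≤ 1`, then `1 − ε₂ ≤ ∫_c exp(Σ_k (Ad(c)a_k)·Y_k + X₂(c)) dc ≤ 1 + ε₂ + (ε₁+ε₂)²`. [folklore] -/
theorem haar_integral_exp_linear_sandwich {ι : Type*} [Fintype ι] (a Y : ι → Fin 3 → ℝ) {X₂ : SU2 → ℝ} (hX₂m : Measurable X₂) {ε₁ ε₂ : ℝ}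
    (h1 : ∀ c : SU2, |∑ k, (adRot c).mulVec (a k) ⬝ᵥ Y k| ≤ ε₁) (h2 : ∀ c, |X₂ c| ≤ ε₂) (hε : ε₁ + ε₂ ≤ 1) :
    1 - ε₂ ≤ ∫ c, Real.exp (∑ k, (adRot c).mulVec (a k) ⬝ᵥ Y k + X₂ c) ∂haarProbability SU2 ∧
      ∫ c, Real.exp (∑ k, (adRot c).mulVec (a k) ⬝ᵥ Y k + X₂ c) ∂haarProbability SU2 ≤ 1 + ε₂ + (ε₁ + ε₂) ^ 2 := by
  haveI : SecondCountableTopology SU2 := secondCountableTopology_su2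
  have hm : Measurable fun c : SU2 => ∑ k, (adRot c).mulVec (a k) ⬝ᵥ Y k :=
    Finset.measurable_sum _ fun k _ => Continuous.measurable ((continuous_adRot_mulVec (a k)).dotProduct continuous_const)
  have hmean : ∫ c, ∑ k, (adRot c).mulVec (a k) ⬝ᵥ Y k ∂haarProbability SU2 = 0 := by
    rw [integral_finsetSum _ fun k _ => ?_]
    · simp [integral_adRot_mulVec_dotProduct_eq_zero]
    · exact integrable_of_measurable_abs_le _ (Continuous.measurable ((continuous_adRot_mulVec (a k)).dotProduct continuous_const))
        (C := 3 * (‖a k‖ * 3) * ‖Y k‖) fun c => by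
          -- crude bound `|x·y| ≤ Σ|x_i||y_i| ≤ 3‖x‖∞‖y‖∞` and `‖Ad(c)a‖∞ ≤ 3‖a‖`-type
          have hx : ∀ i, |(adRot c).mulVec (a k) i| ≤ ‖a k‖ * 3 := fun i => by
            have h1 : |(adRot c).mulVec (a k) i| ^ 2 ≤ ∑ j, ((adRot c).mulVec (a k) j) ^ 2 := by
              rw [sq_abs]; exact Finset.single_le_sum (f := fun j => ((adRot c).mulVec (a k) j) ^ 2) (fun j _ => sq_nonneg _) (Finset.mem_univ i)
            rw [sum_sq_adRot_mulVec] at h1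
            have h2 : ∑ j, a k j ^ 2 ≤ 3 * ‖a k‖ ^ 2 := by
              calc ∑ j, a k j ^ 2 ≤ ∑ _j : Fin 3, ‖a k‖ ^ 2 := Finset.sum_le_sum fun j _ => by
                      rw [← sq_abs]; exact pow_le_pow_left₀ (abs_nonneg _) (by rw [← Real.norm_eq_abs]; exact norm_le_pi_norm (a k) j) 2
                _ = 3 * ‖a k‖ ^ 2 := by simp
            nlinarith [abs_nonneg ((adRot c).mulVec (a k) i), norm_nonneg (a k)]
          have hy : ∀ i, |Y k i| ≤ ‖Y k‖ := fun i => by rw [← Real.norm_eq_abs]; exact norm_le_pi_norm (Y k) i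
          calc |(adRot c).mulVec (a k) ⬝ᵥ Y k| = |∑ i, (adRot c).mulVec (a k) i * Y k i| := rfl
            _ ≤ ∑ i, |(adRot c).mulVec (a k) i * Y k i| := Finset.abs_sum_le_sum_abs _ _
            _ ≤ ∑ _i : Fin 3, ‖a k‖ * 3 * ‖Y k‖ := Finset.sum_le_sum fun i _ => by
                rw [abs_mul]; exact mul_le_mul (hx i) (hy i) (abs_nonneg _) (by positivity)
            _ = 3 * (‖a k‖ * 3) * ‖Y k‖ := by simp; ring
  exact integral_exp_sandwich_of_integral_eq_zero (haarProbability SU2) hm hX₂m h1 h2 hε hmean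

end Summit.QuantumFields.YangMills.Theorems.FemtoTransferGap.TwoLattice.ConstTube

end
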